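import Mathlib
import Summits.Ventures.FusionMHD.Models.FluxSurfacePolarRayTube
import HarnessLib

/-!
# Polar-ray chart, LEVEL direction: the glued ray radius as a function of the flux LEVEL `u`, `∂ρ/∂u = 1/D_r`,
# and the LEIBNIZ RULE ACROSS FLUX SURFACES `d/du ∫ₐᵇ k(θ, ρ_u(θ)) dθ = ∫ₐᵇ (∂_s k)(θ, ρ_u(θ))/D_r(θ, ρ_u(θ)) dθ`

LADDER-GRIDFUSION (F2 item R2 / F1 on the Cerfon–Freidberg rung), cell `gridfusion`, seat `gridfusion-model-7` (g5), 2026-08-27.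
Sixth file of the polar-ray series `Models/FluxSurfacePolarRay{,Glue,Deriv,Loop,Tube}.lean` (★ #88, «#88′ RHO-REGULARITY»,
«F2.R2-POLAR-TUBE»).  Those files treat ONE surface `ψ = u`: the glued ray radius `ρ(θ) = rayRadius ψ R_c Z_c u θ`, its
continuity and `C¹`-regularity IN `θ`, and Freidberg's `q = (F/2π)∮ dl/(R²B_p) = (F/2π)∫₀^{2π} ρ/(R·|D_r|) dθ` (6.35) on the
polar loop.  THIS FILE moves ACROSS surfaces: it differentiates in the LEVEL `u`.

WHY (the GGJ inputs on an IMPLICIT surface).  Jardin's flux-coordinate Mercier criterion (8.134)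
(`Literature/MathematicalPhysics/MHD/MercierFluxForm.lean`) needs, besides surface integrals, their LABEL DERIVATIVES
`V″ = d²V/dψ²`, `Φ″ = 2π·dq/dψ` (shear `Λ = −Ψ′²q′`) and `I′`.  On the Lee–Cerfon / PCF Solov'ev family the surfaces are an
explicit loop in the label `r` and gridfusion-model-5 differentiated under the integral in closed form
(`Literature/…/SolovevFluxSurfaceGGJDerivs.lean`).  On the Cerfon–Freidberg rung (★ #117 «F2.CF-Q-INTERIOR-ITER»,
`Models/CerfonFreidbergIterLikeQHalf.lean`) the surface has NO closed form: it is the graph `s = ρ_u(θ)` of the glued ray radius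
over the rays from the magnetic axis, certified panel by panel.  The label derivative of ANY functional
`u ↦ ∫ₐᵇ k(θ, ρ_u(θ)) dθ` is then the subject of this file: with `∂ρ_u(θ)/∂u = 1/D_r(θ, ρ_u(θ))` (inverse-function rule along
the ray, `D_r = ∂_s ψ(ray_θ s)`), dominated differentiation gives ONE MORE θ-INTEGRAL OF AN EXPLICIT KERNEL,
`∫ₐᵇ (∂_s k)(θ, ρ_u θ)/D_r(θ, ρ_u θ) dθ` — i.e. `V″(u)`, `q′(u)` are «two more top registers» of the program that certified `q(u)`
(F2-SCOPING v1.5 §9(d)), with NO new analysis per instance.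

WHAT IS PROVED (elementary real analysis, [folklore]; no equilibrium, no device):
* §1 (one direction `θ`, LEVEL MARGINS `ψ(ray s) ≤ u_in` on the core `0 < s ≤ s₁`, `u_out ≤ ψ(ray s₂)`, profile continuous and
  strictly increasing on `[s₁, s₂]`): for every level `u ∈ (u_in, u_out)` the glued radius is THE root in `(s₁, s₂)`
  (`rayRadius_level_spec`); `u ↦ ρ_u(θ)` is strictly increasing (`strictMonoOn_rayRadius_level`), continuous
  (`continuousAt_rayRadius_level`), and **`hasDerivAt_rayRadius_level`**: `HasDerivAt (u ↦ ρ_u θ) D₀⁻¹ u₀` whenever the profile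
  has derivative `D₀ ≠ 0` at `ρ_{u₀}(θ)`.
* §2 `LevelPanel ψ R_c Z_c a b s₁ s₂ u_in u_out D` — the PANEL HYPOTHESES WITH LEVEL MARGINS, i.e. exactly what a panel certificate
  of the program lane delivers (★ #117's `panel_bracket` inputs): joint continuity of `(θ, s) ↦ ψ(ray_θ s)` on `[a,b] × [s₁,s₂]`,
  `HasDerivAt (s ↦ ψ(ray_θ s)) (D θ s) s` there with `D` jointly continuous and `> 0`, core below `u_in`, outer bracket above
  `u_out`.  Consequences for every `u ∈ (u_in, u_out)`: the one-surface panel hypotheses of the Glue file (`LevelPanel.spec`,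
  `.continuousOn_rayRadius`), `∂ρ/∂u = 1/D` (`.hasDerivAt_rayRadius`), and the main theorem
  **`LevelPanel.hasDerivAt_integral`**: for a kernel `k` with `HasDerivAt (k θ) (k₁ θ s) s` on the box, `k`, `k₁` jointly
  continuous, `HasDerivAt (u ↦ ∫ₐᵇ k(θ, ρ_u θ) dθ) (∫ₐᵇ k₁(θ, ρ_{u₀} θ)/D(θ, ρ_{u₀} θ) dθ) u₀` and the derivative integrand is
  integrable (Mathlib `intervalIntegral.hasDerivAt_integral_of_dominated_loc_of_deriv_le`; the uniform bound `sup|k₁|/inf D`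
  comes from compactness of the box — NO Lipschitz datum is asked of a certificate).
  `hasDerivAt_integral_of_adjacent`: panels of a partition add up (`∫_{t₀}^{t_N}`), so a loop is differentiated panel by panel.
* (next file `Models/FluxSurfacePolarRayLevelKernels.lean`) the two NAMED kernels — `V′` (Jardin (5.29) = Freidberg (6.22))
  and `q` (Freidberg (6.35)) — with their `s`-derivatives and the panel pieces of `V″(u₀)` and `q′(u₀)`.
MODELLED: nothing.  NOT CLAIMED: any value for any equilibrium; that an instance's code lists `D`, `D₁` are `∂_sψ`, `∂_s²ψ`
(per-instance kernel facts, cf. `…QHalfRay`); the loop-level bridge to `GradShafranov.volumeDerivE` / `safetyFactorE`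
(later file).
-/

noncomputable section

open Real Set Filter Topology MeasureTheory intervalIntegral

namespace Summit.Ventures.FusionMHD.Models

namespace PolarRay

/-! ## §1 One direction: the ray radius as a function of the LEVEL -/

section levelPointwise

variable {ψ : ℝ → ℝ → ℝ} {Rc Zc θ s₁ s₂ uin uout : ℝ}

/-- **LEVEL MARGINS ⇒ THE ROOT FOR EVERY NEARBY LEVEL.**  If along the ray the profile is `≤ u_in` on the core `(0, s₁]`,
continuous and strictly increasing on `[s₁, s₂]`, and `≥ u_out` at `s₂`, then for EVERY level `u ∈ (u_in, u_out)` the glued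
radius satisfies `ρ_u(θ) ∈ (s₁, s₂)` and `ψ(ray_θ ρ_u(θ)) = u`. [folklore] -/
theorem rayRadius_level_spec (hs₁ : 0 < s₁) (hs : s₁ ≤ s₂)
    (hin : ∀ s, 0 < s → s ≤ s₁ → rayProfile ψ Rc Zc θ s ≤ uin)
    (hcont : ContinuousOn (rayProfile ψ Rc Zc θ) (Icc s₁ s₂))
    (hmono : StrictMonoOn (rayProfile ψ Rc Zc θ) (Icc s₁ s₂))
    (hout : uout ≤ rayProfile ψ Rc Zc θ s₂) {u : ℝ} (hu : u ∈ Ioo uin uout) :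
    rayRadius ψ Rc Zc u θ ∈ Ioo s₁ s₂ ∧ rayProfile ψ Rc Zc θ (rayRadius ψ Rc Zc u θ) = u := by
  obtain ⟨h1, h2, -⟩ := rayRadius_spec hs₁ hs (fun s hs0 hss => (hin s hs0 hss).trans_lt hu.1) hcont hmono
    (hu.2.trans_le hout)
  exact ⟨h1, h2⟩

/-- Uniqueness at every nearby level: a radius `s ∈ (0, s₂]` on the level `u ∈ (u_in, u_out)` IS `ρ_u(θ)`. [folklore] -/
theorem eq_rayRadius_of_level (hs₁ : 0 < s₁) (hs : s₁ ≤ s₂)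
    (hin : ∀ s, 0 < s → s ≤ s₁ → rayProfile ψ Rc Zc θ s ≤ uin)
    (hcont : ContinuousOn (rayProfile ψ Rc Zc θ) (Icc s₁ s₂))
    (hmono : StrictMonoOn (rayProfile ψ Rc Zc θ) (Icc s₁ s₂))
    (hout : uout ≤ rayProfile ψ Rc Zc θ s₂) {u s : ℝ} (hu : u ∈ Ioo uin uout)
    (hs0 : 0 < s) (hs2 : s ≤ s₂) (hlev : rayProfile ψ Rc Zc θ s = u) : s = rayRadius ψ Rc Zc u θ := by
  obtain ⟨-, -, h3⟩ := rayRadius_spec hs₁ hs (fun s hs0 hss => (hin s hs0 hss).trans_lt hu.1) hcont hmono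
    (hu.2.trans_le hout)
  exact h3 s hs0 hs2 hlev

/-- **`u ↦ ρ_u(θ)` IS STRICTLY INCREASING** on the admissible levels (outer surfaces enclose inner ones along every ray).
[folklore] -/
theorem strictMonoOn_rayRadius_level (hs₁ : 0 < s₁) (hs : s₁ ≤ s₂)
    (hin : ∀ s, 0 < s → s ≤ s₁ → rayProfile ψ Rc Zc θ s ≤ uin)
    (hcont : ContinuousOn (rayProfile ψ Rc Zc θ) (Icc s₁ s₂))
    (hmono : StrictMonoOn (rayProfile ψ Rc Zc θ) (Icc s₁ s₂))
    (hout : uout ≤ rayProfile ψ Rc Zc θ s₂) :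
    StrictMonoOn (fun u => rayRadius ψ Rc Zc u θ) (Ioo uin uout) := by
  intro u hu v hv huv
  obtain ⟨huI, huρ⟩ := rayRadius_level_spec hs₁ hs hin hcont hmono hout hu
  obtain ⟨hvI, hvρ⟩ := rayRadius_level_spec hs₁ hs hin hcont hmono hout hv
  by_contra hle
  have h := hmono.monotoneOn (Ioo_subset_Icc_self hvI) (Ioo_subset_Icc_self huI) (not_lt.1 hle)
  rw [huρ, hvρ] at h
  exact absurd huv (not_lt.2 h)

/-- **`u ↦ ρ_u(θ)` IS CONTINUOUS** at every admissible level (the image of the admissible levels is a neighbourhood of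
`ρ_{u₀}(θ)`: every nearby radius is the root of its own level). [folklore] -/
theorem continuousAt_rayRadius_level (hs₁ : 0 < s₁) (hs : s₁ ≤ s₂)
    (hin : ∀ s, 0 < s → s ≤ s₁ → rayProfile ψ Rc Zc θ s ≤ uin)
    (hcont : ContinuousOn (rayProfile ψ Rc Zc θ) (Icc s₁ s₂))
    (hmono : StrictMonoOn (rayProfile ψ Rc Zc θ) (Icc s₁ s₂))
    (hout : uout ≤ rayProfile ψ Rc Zc θ s₂) {u₀ : ℝ} (hu₀ : u₀ ∈ Ioo uin uout) :
    ContinuousAt (fun u => rayRadius ψ Rc Zc u θ) u₀ := by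
  obtain ⟨hρI, hρu⟩ := rayRadius_level_spec hs₁ hs hin hcont hmono hout hu₀
  have hIcc : Icc s₁ s₂ ∈ 𝓝 (rayRadius ψ Rc Zc u₀ θ) := Icc_mem_nhds hρI.1 hρI.2
  have hfc : ContinuousAt (rayProfile ψ Rc Zc θ) (rayRadius ψ Rc Zc u₀ θ) := hcont.continuousAt hIcc
  have hpre : rayProfile ψ Rc Zc θ ⁻¹' Ioo uin uout ∈ 𝓝 (rayRadius ψ Rc Zc u₀ θ) :=
    hfc.preimage_mem_nhds (by rw [hρu]; exact Ioo_mem_nhds hu₀.1 hu₀.2)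
  refine (strictMonoOn_rayRadius_level hs₁ hs hin hcont hmono hout).continuousAt_of_image_mem_nhds
    (Ioo_mem_nhds hu₀.1 hu₀.2) ?_
  apply Filter.mem_of_superset (Filter.inter_mem (Ioo_mem_nhds hρI.1 hρI.2) hpre)
  rintro s ⟨hsI, hsu⟩
  exact ⟨rayProfile ψ Rc Zc θ s, hsu,
    (eq_rayRadius_of_level hs₁ hs hin hcont hmono hout hsu (hs₁.trans hsI.1) hsI.2.le rfl).symm⟩

/-- **`∂ρ/∂u = 1/D_r`** (inverse-function rule along the ray): if the profile has derivative `D₀ ≠ 0` at `ρ_{u₀}(θ)`, then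
`HasDerivAt (u ↦ ρ_u θ) D₀⁻¹ u₀`. [folklore] -/
theorem hasDerivAt_rayRadius_level (hs₁ : 0 < s₁) (hs : s₁ ≤ s₂)
    (hin : ∀ s, 0 < s → s ≤ s₁ → rayProfile ψ Rc Zc θ s ≤ uin)
    (hcont : ContinuousOn (rayProfile ψ Rc Zc θ) (Icc s₁ s₂))
    (hmono : StrictMonoOn (rayProfile ψ Rc Zc θ) (Icc s₁ s₂))
    (hout : uout ≤ rayProfile ψ Rc Zc θ s₂) {u₀ D₀ : ℝ} (hu₀ : u₀ ∈ Ioo uin uout)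
    (hD : HasDerivAt (rayProfile ψ Rc Zc θ) D₀ (rayRadius ψ Rc Zc u₀ θ)) (hD0 : D₀ ≠ 0) :
    HasDerivAt (fun u => rayRadius ψ Rc Zc u θ) D₀⁻¹ u₀ := by
  refine HasDerivAt.of_local_left_inverse (continuousAt_rayRadius_level hs₁ hs hin hcont hmono hout hu₀) hD hD0 ?_
  filter_upwards [Ioo_mem_nhds hu₀.1 hu₀.2] with u hu
  exact (rayRadius_level_spec hs₁ hs hin hcont hmono hout hu).2

end levelPointwise

/-! ## §2 A panel with level margins, and the Leibniz rule across surfaces -/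

/-- **PANEL HYPOTHESES WITH LEVEL MARGINS** on the box `[a, b] × [s₁, s₂]` of the polar-ray chart centred at `(R_c, Z_c)`:
joint continuity of the ray profile `(θ, s) ↦ ψ(R_c + s cos θ, Z_c + s sin θ)`, a jointly continuous POSITIVE radial-derivative field
`D` with `HasDerivAt (s ↦ ψ(ray_θ s)) (D θ s) s` on the box, the core `0 < s ≤ s₁` below the level `u_in` and the outer radius `s₂`
above `u_out`.  Every level `u ∈ (u_in, u_out)` then satisfies the one-surface panel hypotheses of `FluxSurfacePolarRayGlue`.
(These are the facts ★ #117's per-panel certificates establish: residual + slope on the tube, `D ≥ μ > 0`, core boxes below the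
level with margin.) [folklore] -/
structure LevelPanel (ψ : ℝ → ℝ → ℝ) (Rc Zc a b s₁ s₂ uin uout : ℝ) (D : ℝ → ℝ → ℝ) : Prop where
  /-- the panel is an interval -/
  hab : a ≤ b
  /-- the bracket starts at a positive radius -/
  hs₁ : 0 < s₁
  /-- the bracket is an interval -/
  hs₁₂ : s₁ ≤ s₂
  /-- joint continuity of the ray profile on the box -/
  cont : ContinuousOn (fun p : ℝ × ℝ => rayProfile ψ Rc Zc p.1 p.2) (Icc a b ×ˢ Icc s₁ s₂)
  /-- `D` is the radial derivative of the profile on the box -/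
  slope : ∀ θ ∈ Icc a b, ∀ s ∈ Icc s₁ s₂, HasDerivAt (rayProfile ψ Rc Zc θ) (D θ s) s
  /-- `D` is jointly continuous on the box -/
  slopeCont : ContinuousOn (fun p : ℝ × ℝ => D p.1 p.2) (Icc a b ×ˢ Icc s₁ s₂)
  /-- `D > 0` on the box -/
  slopePos : ∀ θ ∈ Icc a b, ∀ s ∈ Icc s₁ s₂, 0 < D θ s
  /-- the core is below the level `u_in` -/
  inner : ∀ θ ∈ Icc a b, ∀ s, 0 < s → s ≤ s₁ → rayProfile ψ Rc Zc θ s ≤ uin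
  /-- the outer radius is above the level `u_out` -/
  outer : ∀ θ ∈ Icc a b, uout ≤ rayProfile ψ Rc Zc θ s₂

namespace LevelPanel

variable {ψ : ℝ → ℝ → ℝ} {Rc Zc a b s₁ s₂ uin uout : ℝ} {D : ℝ → ℝ → ℝ}

/-- The profile is continuous on the bracket at every direction of the panel. [folklore] -/
theorem continuousOn_rayProfile (P : LevelPanel ψ Rc Zc a b s₁ s₂ uin uout D) {θ : ℝ} (hθ : θ ∈ Icc a b) :
    ContinuousOn (rayProfile ψ Rc Zc θ) (Icc s₁ s₂) :=
  fun s hs => (P.slope θ hθ s hs).continuousAt.continuousWithinAt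

/-- The profile is strictly increasing on the bracket (`D > 0`). [folklore] -/
theorem strictMonoOn_rayProfile (P : LevelPanel ψ Rc Zc a b s₁ s₂ uin uout D) {θ : ℝ} (hθ : θ ∈ Icc a b) :
    StrictMonoOn (rayProfile ψ Rc Zc θ) (Icc s₁ s₂) :=
  strictMonoOn_rayProfile_of_deriv_pos (P.continuousOn_rayProfile hθ) fun s hs => by
    rw [(P.slope θ hθ s (Ioo_subset_Icc_self hs)).deriv]; exact P.slopePos θ hθ s (Ioo_subset_Icc_self hs)

/-- For every admissible level the one-surface (strict) core hypothesis of the Glue file holds. [folklore] -/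
theorem inner_lt (P : LevelPanel ψ Rc Zc a b s₁ s₂ uin uout D) {u : ℝ} (hu : u ∈ Ioo uin uout) :
    ∀ θ ∈ Icc a b, ∀ s, 0 < s → s ≤ s₁ → rayProfile ψ Rc Zc θ s < u :=
  fun θ hθ s hs0 hss => (P.inner θ hθ s hs0 hss).trans_lt hu.1

/-- … and the outer one. [folklore] -/
theorem lt_outer (P : LevelPanel ψ Rc Zc a b s₁ s₂ uin uout D) {u : ℝ} (hu : u ∈ Ioo uin uout) :
    ∀ θ ∈ Icc a b, u < rayProfile ψ Rc Zc θ s₂ :=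
  fun θ hθ => hu.2.trans_le (P.outer θ hθ)

/-- **EVERY ADMISSIBLE LEVEL IS A CERTIFIED SURFACE ON THE PANEL**: `ρ_u(θ) ∈ (s₁, s₂)` and `ψ(ray_θ ρ_u(θ)) = u` for
`θ ∈ [a, b]`, `u ∈ (u_in, u_out)`. [folklore] -/
theorem spec (P : LevelPanel ψ Rc Zc a b s₁ s₂ uin uout D) {u : ℝ} (hu : u ∈ Ioo uin uout) {θ : ℝ} (hθ : θ ∈ Icc a b) :
    rayRadius ψ Rc Zc u θ ∈ Ioo s₁ s₂ ∧ rayProfile ψ Rc Zc θ (rayRadius ψ Rc Zc u θ) = u :=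
  rayRadius_level_spec P.hs₁ P.hs₁₂ (P.inner θ hθ) (P.continuousOn_rayProfile hθ) (P.strictMonoOn_rayProfile hθ)
    (P.outer θ hθ) hu

/-- `θ ↦ ρ_u(θ)` is continuous on the panel for every admissible level (Glue file). [folklore] -/
theorem continuousOn_rayRadius (P : LevelPanel ψ Rc Zc a b s₁ s₂ uin uout D) {u : ℝ} (hu : u ∈ Ioo uin uout) :
    ContinuousOn (rayRadius ψ Rc Zc u) (Icc a b) :=
  PolarRay.continuousOn_rayRadius P.cont P.hs₁ P.hs₁₂ (P.inner_lt hu) (fun _ hθ => P.strictMonoOn_rayProfile hθ)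
    (P.lt_outer hu)

/-- `θ ↦ (θ, ρ_u(θ))` maps the panel continuously INTO the box. [folklore] -/
theorem graph_continuousOn_mapsTo (P : LevelPanel ψ Rc Zc a b s₁ s₂ uin uout D) {u : ℝ} (hu : u ∈ Ioo uin uout) :
    ContinuousOn (fun θ => (θ, rayRadius ψ Rc Zc u θ)) (Icc a b)
      ∧ MapsTo (fun θ => (θ, rayRadius ψ Rc Zc u θ)) (Icc a b) (Icc a b ×ˢ Icc s₁ s₂) :=
  ⟨continuousOn_id.prodMk (P.continuousOn_rayRadius hu),
    fun _ hθ => ⟨hθ, Ioo_subset_Icc_self (P.spec hu hθ).1⟩⟩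

/-- **`∂ρ/∂u = 1/D(θ, ρ_u θ)` on the panel.** [folklore] -/
theorem hasDerivAt_rayRadius (P : LevelPanel ψ Rc Zc a b s₁ s₂ uin uout D) {u : ℝ} (hu : u ∈ Ioo uin uout) {θ : ℝ}
    (hθ : θ ∈ Icc a b) :
    HasDerivAt (fun v => rayRadius ψ Rc Zc v θ) (D θ (rayRadius ψ Rc Zc u θ))⁻¹ u :=
  have hρ := P.spec hu hθ
  hasDerivAt_rayRadius_level P.hs₁ P.hs₁₂ (P.inner θ hθ) (P.continuousOn_rayProfile hθ) (P.strictMonoOn_rayProfile hθ)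
    (P.outer θ hθ) hu (P.slope θ hθ _ (Ioo_subset_Icc_self hρ.1)) (P.slopePos θ hθ _ (Ioo_subset_Icc_self hρ.1)).ne'

/-- A jointly continuous kernel evaluated along an admissible surface is continuous on the panel, hence integrable.
[folklore] -/
theorem continuousOn_kernel (P : LevelPanel ψ Rc Zc a b s₁ s₂ uin uout D) {k : ℝ → ℝ → ℝ}
    (hkc : ContinuousOn (fun p : ℝ × ℝ => k p.1 p.2) (Icc a b ×ˢ Icc s₁ s₂)) {u : ℝ} (hu : u ∈ Ioo uin uout) :
    ContinuousOn (fun θ => k θ (rayRadius ψ Rc Zc u θ)) (Icc a b) :=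
  hkc.comp (P.graph_continuousOn_mapsTo hu).1 (P.graph_continuousOn_mapsTo hu).2

/-- … integrable version. [folklore] -/
theorem intervalIntegrable_kernel (P : LevelPanel ψ Rc Zc a b s₁ s₂ uin uout D) {k : ℝ → ℝ → ℝ}
    (hkc : ContinuousOn (fun p : ℝ × ℝ => k p.1 p.2) (Icc a b ×ˢ Icc s₁ s₂)) {u : ℝ} (hu : u ∈ Ioo uin uout) :
    IntervalIntegrable (fun θ => k θ (rayRadius ψ Rc Zc u θ)) volume a b :=
  ContinuousOn.intervalIntegrable (by rw [uIcc_of_le P.hab]; exact P.continuousOn_kernel hkc hu)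

/-- … and for all levels near an admissible one (the form `hasDerivAt_integral_of_adjacent` consumes). [folklore] -/
theorem eventually_intervalIntegrable_kernel (P : LevelPanel ψ Rc Zc a b s₁ s₂ uin uout D) {k : ℝ → ℝ → ℝ}
    (hkc : ContinuousOn (fun p : ℝ × ℝ => k p.1 p.2) (Icc a b ×ˢ Icc s₁ s₂)) {u₀ : ℝ} (hu₀ : u₀ ∈ Ioo uin uout) :
    ∀ᶠ u in 𝓝 u₀, IntervalIntegrable (fun θ => k θ (rayRadius ψ Rc Zc u θ)) volume a b := by
  filter_upwards [Ioo_mem_nhds hu₀.1 hu₀.2] with u hu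
  exact P.intervalIntegrable_kernel hkc hu

/-- The derivative integrand `k₁(θ, ρ_u θ)/D(θ, ρ_u θ)` is continuous on the panel. [folklore] -/
theorem continuousOn_kernel_div (P : LevelPanel ψ Rc Zc a b s₁ s₂ uin uout D) {k₁ : ℝ → ℝ → ℝ}
    (hk₁c : ContinuousOn (fun p : ℝ × ℝ => k₁ p.1 p.2) (Icc a b ×ˢ Icc s₁ s₂)) {u : ℝ} (hu : u ∈ Ioo uin uout) :
    ContinuousOn (fun θ => k₁ θ (rayRadius ψ Rc Zc u θ) / D θ (rayRadius ψ Rc Zc u θ)) (Icc a b) :=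
  (P.continuousOn_kernel hk₁c hu).div (P.continuousOn_kernel P.slopeCont hu)
    fun θ hθ => (P.slopePos θ hθ _ (Ioo_subset_Icc_self (P.spec hu hθ).1)).ne'

/-- **THE LEIBNIZ RULE ACROSS FLUX SURFACES (one panel).**  Under the panel hypotheses with level margins and for a kernel
`k(θ, s)` with `s`-derivative `k₁` on the box (`k`, `k₁` jointly continuous), at every admissible level `u₀`:
`d/du|_{u₀} ∫ₐᵇ k(θ, ρ_u(θ)) dθ = ∫ₐᵇ k₁(θ, ρ_{u₀}(θ))/D(θ, ρ_{u₀}(θ)) dθ`, and that integrand is integrable.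
(Dominated differentiation under the integral; the dominating constant is `sup|k₁|/inf D` over the compact box.)
[folklore] -/
theorem hasDerivAt_integral (P : LevelPanel ψ Rc Zc a b s₁ s₂ uin uout D) {k k₁ : ℝ → ℝ → ℝ} {u₀ : ℝ}
    (hu₀ : u₀ ∈ Ioo uin uout)
    (hk : ∀ θ ∈ Icc a b, ∀ s ∈ Icc s₁ s₂, HasDerivAt (k θ) (k₁ θ s) s)
    (hkc : ContinuousOn (fun p : ℝ × ℝ => k p.1 p.2) (Icc a b ×ˢ Icc s₁ s₂))
    (hk₁c : ContinuousOn (fun p : ℝ × ℝ => k₁ p.1 p.2) (Icc a b ×ˢ Icc s₁ s₂)) :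
    IntervalIntegrable (fun θ => k₁ θ (rayRadius ψ Rc Zc u₀ θ) / D θ (rayRadius ψ Rc Zc u₀ θ)) volume a b ∧
    HasDerivAt (fun u => ∫ θ in a..b, k θ (rayRadius ψ Rc Zc u θ))
      (∫ θ in a..b, k₁ θ (rayRadius ψ Rc Zc u₀ θ) / D θ (rayRadius ψ Rc Zc u₀ θ)) u₀ := by
  have hK : IsCompact (Icc a b ×ˢ Icc s₁ s₂) := isCompact_Icc.prod isCompact_Icc
  -- uniform bounds on the box: |k₁| ≤ C, D ≥ m > 0
  obtain ⟨C, hC⟩ := hK.exists_bound_of_continuousOn hk₁c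
  obtain ⟨m, hm0, hm⟩ := hK.exists_forall_le' P.slopeCont (a := (0 : ℝ)) fun p hp => P.slopePos p.1 hp.1 p.2 hp.2
  have hs : Ioo uin uout ∈ 𝓝 u₀ := Ioo_mem_nhds hu₀.1 hu₀.2
  have hIoc : ∀ θ ∈ uIoc a b, θ ∈ Icc a b := fun θ hθ => by
    rw [uIoc_of_le P.hab] at hθ; exact Ioc_subset_Icc_self hθ
  have key := intervalIntegral.hasDerivAt_integral_of_dominated_loc_of_deriv_le (μ := volume) (a := a) (b := b)
    (F := fun u θ => k θ (rayRadius ψ Rc Zc u θ))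
    (F' := fun u θ => k₁ θ (rayRadius ψ Rc Zc u θ) / D θ (rayRadius ψ Rc Zc u θ)) (x₀ := u₀)
    (bound := fun _ => C / m) hs
    (Filter.eventually_of_mem hs fun u hu => by
      rw [uIoc_of_le P.hab]
      exact ((P.continuousOn_kernel hkc hu).mono Ioc_subset_Icc_self).aestronglyMeasurable measurableSet_Ioc)
    (P.intervalIntegrable_kernel hkc hu₀)
    (by
      rw [uIoc_of_le P.hab]
      exact ((P.continuousOn_kernel_div hk₁c hu₀).mono Ioc_subset_Icc_self).aestronglyMeasurable measurableSet_Ioc)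
    (Filter.Eventually.of_forall fun θ hθ u hu => by
      have hθ' := hIoc θ hθ
      have hρ := (P.spec hu hθ').1
      have hmem : (θ, rayRadius ψ Rc Zc u θ) ∈ Icc a b ×ˢ Icc s₁ s₂ := ⟨hθ', Ioo_subset_Icc_self hρ⟩
      have hDpos : 0 < D θ (rayRadius ψ Rc Zc u θ) := P.slopePos θ hθ' _ (Ioo_subset_Icc_self hρ)
      have hC0 : 0 ≤ C := (norm_nonneg _).trans (hC _ hmem)
      rw [Real.norm_eq_abs, abs_div, abs_of_pos hDpos]
      apply div_le_div₀ hC0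
      · simpa [Real.norm_eq_abs] using hC _ hmem
      · exact hm0
      · exact hm _ hmem)
    intervalIntegrable_const
    (Filter.Eventually.of_forall fun θ hθ u hu => by
      have hθ' := hIoc θ hθ
      have hρ := (P.spec hu hθ').1
      have hk' := hk θ hθ' _ (Ioo_subset_Icc_self hρ)
      have hρ' := P.hasDerivAt_rayRadius hu hθ'
      exact (hk'.comp u hρ').congr_deriv (by rw [div_eq_mul_inv]))
  exact key

end LevelPanel

/-- **PANELS ADD UP.**  If on each panel `[t_j, t_{j+1}]` (`j < N`) the level-integral has derivative `∫ G` at `u₀`, the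
integrands `F u` are integrable on every panel for `u` near `u₀`, and `G` is integrable on every panel, then
`HasDerivAt (u ↦ ∫_{t₀}^{t_N} F u) (∫_{t₀}^{t_N} G) u₀` — a loop is differentiated panel by panel. [folklore] -/
theorem hasDerivAt_integral_of_adjacent {N : ℕ} {t : ℕ → ℝ} {F : ℝ → ℝ → ℝ} {G : ℝ → ℝ} {u₀ : ℝ}
    (hint : ∀ j < N, ∀ᶠ u in 𝓝 u₀, IntervalIntegrable (F u) volume (t j) (t (j + 1)))
    (hG : ∀ j < N, IntervalIntegrable G volume (t j) (t (j + 1)))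
    (hd : ∀ j < N, HasDerivAt (fun u => ∫ θ in (t j)..(t (j + 1)), F u θ) (∫ θ in (t j)..(t (j + 1)), G θ) u₀) :
    HasDerivAt (fun u => ∫ θ in (t 0)..(t N), F u θ) (∫ θ in (t 0)..(t N), G θ) u₀ := by
  -- near u₀ the whole integral is the sum of the panel integrals
  have hall : ∀ᶠ u in 𝓝 u₀, ∀ j ∈ Finset.range N, IntervalIntegrable (F u) volume (t j) (t (j + 1)) :=
    (Filter.eventually_all_finset _).2 fun j hj => hint j (Finset.mem_range.1 hj)
  have hev : (fun u => ∫ θ in (t 0)..(t N), F u θ)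
      =ᶠ[𝓝 u₀] fun u => ∑ j ∈ Finset.range N, ∫ θ in (t j)..(t (j + 1)), F u θ := by
    filter_upwards [hall] with u hu
    exact (intervalIntegral.sum_integral_adjacent_intervals fun j hj => hu j (Finset.mem_range.2 hj)).symm
  have hsum : HasDerivAt (fun u => ∑ j ∈ Finset.range N, ∫ θ in (t j)..(t (j + 1)), F u θ)
      (∑ j ∈ Finset.range N, ∫ θ in (t j)..(t (j + 1)), G θ) u₀ :=
    HasDerivAt.fun_sum fun j hj => hd j (Finset.mem_range.1 hj)
  rw [← intervalIntegral.sum_integral_adjacent_intervals hG]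
  exact hsum.congr_of_eventuallyEq hev

end PolarRay

end Summit.Ventures.FusionMHD.Models

end
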